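import Mathlib
import Literature.Barriers.PneNP.TSPExtensionComplexity
import HarnessLib

/-!
# Goemans' face-counting bound: an extended formulation of size `r` allows at most `2^r` vertices
# (Goemans 2015, Theorem 1), and the permutahedron needs `≥ log₂ n!` inequalities (Corollary 1) — PROVED

Source: M. X. Goemans, *Smallest compact formulation for the permutahedron*, Math. Program. Ser. B
153 (2015) 5–11 [Goemans2015] (held text `paper:doi-10-1007-s10107-014-0757-1`, §2). Verbatim
(§2): "We first show an elementary lower bound on the number of facets of any extended formulation
`Q` for any polyhedron `P` which, somewhat surprisingly, does not appear to be known. For any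
polyhedron `P`, let `v(P)` denote its number of vertices, `f(P)` its number of faces (of any
dimension), and `t(P)` its number of facets … **Theorem 1** Let `P` be any polyhedron in `ℝⁿ` with
`v(P)` vertices. Then the number of facets `t(Q)` of any [extended formulation `Q` of `P` is at least
`log₂ v(P)`]. Proof Assume that `Q ⊆ ℝ^{n+q}` is an extended formulation of `P`. Consider any face
`F_P` of `P`, and let [`F_Q` be its preimage in `Q`, a face of `Q`] … Every face of a polyhedron `Q`
is the intersection of a subset of the facets of `Q`. Thus, we get that [`v(P) ≤ f(P) ≤ f(Q) ≤
2^{t(Q)}`]. For the permutahedron `P_n`, the fact that `v(P_n) = n! = 2^{Θ(n log n)}` therefore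
implies: **Corollary 1** Any extended formulation `Q` of the permutahedron `P_n` has at least
`Ω(n log n)` facets." (§2: "the permutahedron `P_n` is defined as the convex hull of all permutations
of the set of numbers `[n] := {1, ⋯, n}` … The permutahedron `P_n` has `n!` vertices".)

## What is proved (no named fact)

In the tree's slack-form currency (`ExtendedFormulation ι r`: `Q̂ = {(x, y) : E x + F y = g, y ≥ 0}`
with `r` sign constraints, `HasEFOfSize P r ⟺` some `Q̂` projects onto `P`; FMPTW), where the
facets of `Q̂` are among the `r` inequalities `y_j ≥ 0`:

* `ExtendedFormulation.faceSig Q F ⊆ Fin r` — the set of slack coordinates positive on some lift of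
  some point of `F` (the complement of "the subset of the facets of `Q`" whose intersection is the
  face `F_Q` above `F`);
* `ExtendedFormulation.faceSig_injective` — `F ↦ faceSig F` is injective on the nonempty convex
  extreme subsets `F` of `P` (every nonempty face of a polytope is one). The printed step "every
  face of `Q` is the intersection of a subset of the facets" (LP duality) is replaced by the
  elementary perturbation used in the tree's `TSPExtensionComplexityRectangles.lean`: a lift of `F₁`
  positive on all of `faceSig F₁` (an average of witnesses, `exists_relint_lift`), extrapolated away
  from a lift of a point `v ∈ F₂` with `faceSig F₂ ⊆ faceSig F₁`, stays in `Q̂`; extremality of `F₁`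
  then forces `v ∈ F₁` (`subset_of_faceSig_subset`);
* `HasEFOfSize.natCard_faces_le` — hence `P` has at most `2^r` nonempty convex extreme subsets
  (`f(P) − 1 ≤ 2^{t(Q)}`), and **Theorem 1** `HasEFOfSize.natCard_extremePoints_le`:
  `v(P) = |extreme points of P| ≤ 2^r`, i.e. `log₂ v(P) ≤ r` (`Goemans2015_thm1`); in particular the
  extreme points of a set with an extended formulation form a finite set;
* `permutahedron n = conv{(σ(0)+1, …, σ(n−1)+1) : σ ∈ S_n} ⊆ ℝⁿ`, whose `n!` permutation vectors
  are extreme points (`permVec_mem_extremePoints`: `v_σ` is the unique maximiser of `⟨v_σ, ·⟩` among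
  the generators, since `2⟨v_σ, v_τ⟩ < |v_σ|² + |v_τ|² = 2|v_σ|²` for `τ ≠ σ`; a generator strictly
  preferred by a linear functional is an extreme point of the hull,
  `mem_extremePoints_convexHull_of_dotProduct_lt`), and **Corollary 1** `Goemans2015_cor1`:
  `HasEFOfSize (permutahedron n) r → n! ≤ 2^r` (`log₂ n! ≤ r`, `Goemans2015_cor1_logb`;
  `log₂ n! = Θ(n log n)`).

Not typed here: Theorem 2 (the sorting-network extended formulation, `O(n log n)` via AKS) and
Theorem 3 (dimension lower bound). This is the third classical lower-bound technique for extension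
complexity in the tree next to rectangle covering (`TSPExtensionComplexityRectangles.lean`,
`MatchingRectangleCoveringBarrier.lean`) and hyperplane separation (`Rothvoss2017_thm1`).
-/

noncomputable section

open Finset Matrix

namespace Literature.Barriers.PneNP

variable {ι : Type} [Fintype ι] {r : ℕ}

namespace ExtendedFormulation

variable (Q : ExtendedFormulation ι r)

/-! ### Lifts and the signature of a face -/

/-- The lifted feasible region `Q̂ = {(x, y) : y ≥ 0, E x + F y = g}` of a slack-form system.
[cite: Goemans2015, §2 ("a polyhedron Q ⊆ ℝ^{n+q} is an extended formulation for P if [it projects onto P]")] -/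
def liftSet : Set ((ι → ℝ) × (Fin r → ℝ)) :=
  {z | (∀ j, 0 ≤ z.2 j) ∧ Q.E *ᵥ z.1 + Q.F *ᵥ z.2 = Q.g}

/-- `x ∈ π(Q̂)` iff `x` has a lift. [cite: Goemans2015, §2] -/
theorem mem_projSet_iff {x : ι → ℝ} : x ∈ Q.projSet ↔ ∃ y : Fin r → ℝ, (x, y) ∈ Q.liftSet :=
  Iff.rfl

/-- `Q̂` is convex. [cite: Goemans2015, §2] -/
theorem convex_liftSet : Convex ℝ Q.liftSet := by
  intro z hz z' hz' a b ha hb hab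
  refine ⟨fun j => ?_, ?_⟩
  · simp only [Prod.snd_add, Prod.smul_snd, Pi.add_apply, Pi.smul_apply, smul_eq_mul]
    exact add_nonneg (mul_nonneg ha (hz.1 j)) (mul_nonneg hb (hz'.1 j))
  · simp only [Prod.fst_add, Prod.smul_fst, Prod.snd_add, Prod.smul_snd, mulVec_add, mulVec_smul]
    rw [show a • (Q.E *ᵥ z.1) + b • (Q.E *ᵥ z'.1) + (a • (Q.F *ᵥ z.2) + b • (Q.F *ᵥ z'.2)) =
        a • (Q.E *ᵥ z.1 + Q.F *ᵥ z.2) + b • (Q.E *ᵥ z'.1 + Q.F *ᵥ z'.2) by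
      simp only [smul_add]; abel, hz.2, hz'.2, ← add_smul, hab, one_smul]

/-- Affine extrapolation inside `Q̂`: for `z, z' ∈ Q̂` and `t` with `(1+t) z.y − t z'.y ≥ 0`, the point
`(1+t) z − t z'` lies in `Q̂` (the perturbation step). [cite: Goemans2015, §2, proof of Thm. 1] -/
theorem extrapolate_mem_liftSet {z z' : (ι → ℝ) × (Fin r → ℝ)} (hz : z ∈ Q.liftSet)
    (hz' : z' ∈ Q.liftSet) {t : ℝ} (hnn : ∀ j, 0 ≤ (1 + t) * z.2 j - t * z'.2 j) :
    (1 + t) • z - t • z' ∈ Q.liftSet := by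
  refine ⟨fun j => by simpa using hnn j, ?_⟩
  simp only [Prod.fst_sub, Prod.smul_fst, Prod.snd_sub, Prod.smul_snd, mulVec_sub, mulVec_smul]
  rw [show (1 + t) • (Q.E *ᵥ z.1) - t • (Q.E *ᵥ z'.1) + ((1 + t) • (Q.F *ᵥ z.2) - t • (Q.F *ᵥ z'.2)) =
      (1 + t) • (Q.E *ᵥ z.1 + Q.F *ᵥ z.2) - t • (Q.E *ᵥ z'.1 + Q.F *ᵥ z'.2) by
    simp only [smul_add]; abel, hz.2, hz'.2, ← sub_smul, show (1 + t) - t = 1 by ring,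
    one_smul]

/-- **The signature of a subset `F ⊆ P`**: the slack coordinates `j` that are positive on some lift of
some point of `F` — the complement of the set of facets `y_j ≥ 0` of `Q̂` containing the face of `Q̂`
above `F` ("Every face of a polyhedron `Q` is the intersection of a subset of the facets of `Q`").
[cite: Goemans2015, §2, proof of Thm. 1] -/
def faceSig (F : Set (ι → ℝ)) : Set (Fin r) := {j | ∃ z ∈ Q.liftSet, z.1 ∈ F ∧ 0 < z.2 j}

/-- The signature is monotone. [cite: Goemans2015, §2, proof of Thm. 1] -/
theorem faceSig_mono {F F' : Set (ι → ℝ)} (h : F ⊆ F') : Q.faceSig F ⊆ Q.faceSig F' :=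
  fun _ ⟨z, hz, hzF, hzj⟩ => ⟨z, hz, h hzF, hzj⟩

/-- A nonempty CONVEX subset `F` of `P` has a lift in "relative interior position": a point
`(x*, y*) ∈ Q̂` with `x* ∈ F` and `y*_j > 0` for every `j` in the signature of `F` (average one
witness per coordinate). [cite: Goemans2015, §2, proof of Thm. 1] -/
theorem exists_relint_lift {F : Set (ι → ℝ)} (hF : F ⊆ Q.projSet) (hne : F.Nonempty)
    (hconv : Convex ℝ F) :
    ∃ z ∈ Q.liftSet, z.1 ∈ F ∧ ∀ j ∈ Q.faceSig F, 0 < z.2 j := by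
  classical
  obtain ⟨x₀, hx₀⟩ := hne
  obtain ⟨y₀, hy₀⟩ := Q.mem_projSet_iff.1 (hF hx₀)
  have hch : ∀ j : Fin r, ∃ z ∈ Q.liftSet, z.1 ∈ F ∧ (j ∈ Q.faceSig F → 0 < z.2 j) := by
    intro j
    by_cases hj : j ∈ Q.faceSig F
    · obtain ⟨z, hz, hzF, hzj⟩ := hj
      exact ⟨z, hz, hzF, fun _ => hzj⟩
    · exact ⟨(x₀, y₀), hy₀, hx₀, fun h => absurd h hj⟩
  choose z hz hzF hzj using hch
  -- the witnesses, indexed by `Option (Fin r)` (`none ↦ (x₀, y₀)`), averaged uniformly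
  let p : Option (Fin r) → (ι → ℝ) × (Fin r → ℝ) := fun o => o.elim (x₀, y₀) z
  let N : ℝ := Fintype.card (Option (Fin r))
  have hN : 0 < N := by
    simp only [N, Fintype.card_option]
    positivity
  have hw1 : ∑ _o : Option (Fin r), N⁻¹ = 1 := by
    rw [sum_const, card_univ, nsmul_eq_mul]
    exact mul_inv_cancel₀ hN.ne'
  have hp : ∀ o, p o ∈ Q.liftSet := fun o => by cases o <;> simp [p, hy₀, hz]
  have hp1 : ∀ o, (p o).1 ∈ F := fun o => by cases o <;> simp [p, hx₀, hzF]
  refine ⟨∑ o, N⁻¹ • p o, Q.convex_liftSet.sum_mem (fun _ _ => by positivity) hw1 fun o _ => hp o,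
    ?_, ?_⟩
  · rw [Prod.fst_sum]
    simp only [Prod.smul_fst]
    exact hconv.sum_mem (fun _ _ => by positivity) hw1 fun o _ => hp1 o
  · intro j hj
    rw [Prod.snd_sum, Finset.sum_apply]
    simp only [Prod.smul_snd, Pi.smul_apply, smul_eq_mul]
    have hterm : N⁻¹ * (p (some j)).2 j ≤ ∑ o, N⁻¹ * (p o).2 j :=
      single_le_sum (f := fun o => N⁻¹ * (p o).2 j)
        (fun o _ => mul_nonneg (inv_nonneg.2 hN.le) ((hp o).1 j)) (mem_univ _)
    have hpos : 0 < N⁻¹ * (p (some j)).2 j := mul_pos (inv_pos.2 hN) (by simpa [p] using hzj j hj)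
    exact lt_of_lt_of_le hpos hterm

/-- **The key step.** If `F₁` is a nonempty convex extreme subset of `P = π(Q̂)` and `F₂ ⊆ P` has
`faceSig F₂ ⊆ faceSig F₁`, then `F₂ ⊆ F₁`: extrapolating a relative-interior lift of `F₁` away from a
lift of `v ∈ F₂` stays in `Q̂`, so its projection `x_t ∈ P` has the point of `F₁` in the open segment
`(x_t, v)`, and extremality puts `v` in `F₁`. [cite: Goemans2015, §2, proof of Thm. 1] -/
theorem subset_of_faceSig_subset {F₁ F₂ : Set (ι → ℝ)} (h₁ : IsExtreme ℝ Q.projSet F₁)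
    (hne : F₁.Nonempty) (hconv : Convex ℝ F₁) (h₂ : F₂ ⊆ Q.projSet)
    (hsig : Q.faceSig F₂ ⊆ Q.faceSig F₁) : F₂ ⊆ F₁ := by
  classical
  intro v hv
  obtain ⟨zs, hzs, hzsF, hpos⟩ := Q.exists_relint_lift h₁.1 hne hconv
  obtain ⟨y₀, hy₀⟩ := Q.mem_projSet_iff.1 (h₂ hv)
  have hsupp : ∀ j, 0 < y₀ j → 0 < zs.2 j := fun j hj => hpos j (hsig ⟨(v, y₀), hy₀, hv, hj⟩)
  -- the step size `t = 1/(1 + Σ_j y₀_j / u_j)`, `u_j = zs_j` on the support of `y₀`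
  let u : Fin r → ℝ := fun j => if 0 < y₀ j then zs.2 j else 1
  have hu : ∀ j, 0 < u j := fun j => by
    by_cases h : 0 < y₀ j
    · simp only [u, if_pos h]
      exact hsupp j h
    · simp only [u, if_neg h]
      exact one_pos
  let S : ℝ := ∑ j, y₀ j / u j
  have hS : 0 ≤ S := sum_nonneg fun j _ => div_nonneg (hy₀.1 j) (hu j).le
  let t : ℝ := 1 / (1 + S)
  have ht : 0 < t := by positivity
  have hty : ∀ j, t * y₀ j ≤ zs.2 j := by
    intro j
    by_cases hj : 0 < y₀ j
    · have hz : 0 < zs.2 j := hsupp j hj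
      have hterm : y₀ j / u j ≤ S :=
        single_le_sum (f := fun k => y₀ k / u k) (fun k _ => div_nonneg (hy₀.1 k) (hu k).le)
          (mem_univ j)
      have huj : u j = zs.2 j := by simp only [u, if_pos hj]
      rw [huj] at hterm
      calc t * y₀ j = y₀ j / (1 + S) := by simp only [t]; ring
        _ ≤ y₀ j / (y₀ j / zs.2 j) := div_le_div_of_nonneg_left (hy₀.1 j) (div_pos hj hz) (by linarith)
        _ = zs.2 j := by field_simp
    · have h0 : y₀ j = 0 := le_antisymm (not_lt.1 hj) (hy₀.1 j)
      rw [h0, mul_zero]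
      exact hzs.1 j
  have hmem : (1 + t) • zs - t • ((v, y₀) : (ι → ℝ) × (Fin r → ℝ)) ∈ Q.liftSet :=
    Q.extrapolate_mem_liftSet hzs hy₀ fun j => by
      have h1 := hty j
      have h2 := hzs.1 j
      simp only
      nlinarith
  have hxt : ((1 + t) • zs - t • ((v, y₀) : (ι → ℝ) × (Fin r → ℝ))).1 ∈ Q.projSet :=
    Q.mem_projSet_iff.2 ⟨_, hmem⟩
  have hseg : zs.1 ∈ openSegment ℝ ((1 + t) • zs - t • ((v, y₀) : (ι → ℝ) × (Fin r → ℝ))).1 v := by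
    refine ⟨1 / (1 + t), t / (1 + t), by positivity, by positivity, by field_simp, ?_⟩
    simp only [Prod.fst_sub, Prod.smul_fst, smul_sub, smul_smul]
    rw [show 1 / (1 + t) * (1 + t) = 1 by field_simp, one_smul,
      show 1 / (1 + t) * t = t / (1 + t) by ring, sub_add_cancel]
  exact h₁.2 (h₂ hv) hxt hzsF (by rw [openSegment_symm]; exact hseg)

/-- **Faces are determined by their signatures**: `F ↦ faceSig F ⊆ Fin r` is injective on the
nonempty convex extreme subsets of `P` (so there are at most `2^r` of them — "we get that
`f(P) ≤ f(Q) ≤ 2^{t(Q)}`"). [cite: Goemans2015, §2, proof of Thm. 1] -/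
theorem faceSig_injective :
    Function.Injective
      (fun F : {F : Set (ι → ℝ) // F.Nonempty ∧ Convex ℝ F ∧ IsExtreme ℝ Q.projSet F} =>
        Q.faceSig F.1) := by
  rintro ⟨F₁, hne₁, hc₁, he₁⟩ ⟨F₂, hne₂, hc₂, he₂⟩ h
  have h' : Q.faceSig F₁ = Q.faceSig F₂ := h
  exact Subtype.ext (Set.Subset.antisymm (Q.subset_of_faceSig_subset he₂ hne₂ hc₂ he₁.1 h'.subset)
    (Q.subset_of_faceSig_subset he₁ hne₁ hc₁ he₂.1 h'.symm.subset))

end ExtendedFormulation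

/-! ### Theorem 1 -/

/-- **A set with an extended formulation of size `r` has at most `2^r` nonempty faces** (nonempty
convex extreme subsets; for a polytope these are exactly its nonempty faces):
"`f(P) ≤ f(Q) ≤ 2^{t(Q)}`". [cite: Goemans2015, §2, proof of Thm. 1] -/
theorem HasEFOfSize.natCard_faces_le {P : Set (ι → ℝ)} (h : HasEFOfSize P r) :
    Nat.card {F : Set (ι → ℝ) // F.Nonempty ∧ Convex ℝ F ∧ IsExtreme ℝ P F} ≤ 2 ^ r := by
  classical
  obtain ⟨Q, rfl⟩ := h
  calc Nat.card {F : Set (ι → ℝ) // F.Nonempty ∧ Convex ℝ F ∧ IsExtreme ℝ Q.projSet F}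
      ≤ Nat.card (Set (Fin r)) := Nat.card_le_card_of_injective _ Q.faceSig_injective
    _ = 2 ^ r := by rw [Nat.card_eq_fintype_card, Fintype.card_set, Fintype.card_fin]

/-- The nonempty faces of a set with an extended formulation form a finite family.
[cite: Goemans2015, §2, proof of Thm. 1] -/
theorem HasEFOfSize.finite_faces {P : Set (ι → ℝ)} (h : HasEFOfSize P r) :
    Finite {F : Set (ι → ℝ) // F.Nonempty ∧ Convex ℝ F ∧ IsExtreme ℝ P F} := by
  classical
  obtain ⟨Q, rfl⟩ := h
  exact Finite.of_injective _ Q.faceSig_injective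

/-- **Goemans 2015, Theorem 1** ("Let `P` be any polyhedron in `ℝⁿ` with `v(P)` vertices. Then the
number of facets `t(Q)` of any [extended formulation of `P` is at least `log₂ v(P)`]"), in the tree's
slack-form currency: if `P` has an extended formulation with `r` inequalities then `P` has at most
`2^r` extreme points (vertices are `0`-dimensional faces: `v(P) ≤ f(P)`). [cite: Goemans2015, Thm. 1 (§2)] -/
theorem HasEFOfSize.natCard_extremePoints_le {P : Set (ι → ℝ)} (h : HasEFOfSize P r) :
    Nat.card (P.extremePoints ℝ) ≤ 2 ^ r := by
  classical
  haveI := h.finite_faces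
  let f : P.extremePoints ℝ → {F : Set (ι → ℝ) // F.Nonempty ∧ Convex ℝ F ∧ IsExtreme ℝ P F} :=
    fun x => ⟨{x.1}, Set.singleton_nonempty _, convex_singleton _, isExtreme_singleton.2 x.2⟩
  have hf : Function.Injective f := fun a b hab =>
    Subtype.ext (Set.singleton_eq_singleton_iff.1 (congrArg Subtype.val hab))
  exact (Nat.card_le_card_of_injective f hf).trans h.natCard_faces_le

/-- The extreme points of a set with an extended formulation form a finite set.
[cite: Goemans2015, Thm. 1 (§2)] -/
theorem HasEFOfSize.finite_extremePoints {P : Set (ι → ℝ)} (h : HasEFOfSize P r) :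
    (P.extremePoints ℝ).Finite := by
  classical
  haveI := h.finite_faces
  let f : P.extremePoints ℝ → {F : Set (ι → ℝ) // F.Nonempty ∧ Convex ℝ F ∧ IsExtreme ℝ P F} :=
    fun x => ⟨{x.1}, Set.singleton_nonempty _, convex_singleton _, isExtreme_singleton.2 x.2⟩
  have hf : Function.Injective f := fun a b hab =>
    Subtype.ext (Set.singleton_eq_singleton_iff.1 (congrArg Subtype.val hab))
  exact Set.finite_coe_iff.1 (Finite.of_injective f hf)

/-- **Theorem 1, logarithmic form**: `log₂ v(P) ≤ r` for every extended formulation of `P` with `r`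
inequalities. [cite: Goemans2015, Thm. 1 (§2)] -/
theorem Goemans2015_thm1 {P : Set (ι → ℝ)} (h : HasEFOfSize P r) :
    Real.logb 2 (Nat.card (P.extremePoints ℝ)) ≤ r := by
  have hle : (Nat.card (P.extremePoints ℝ) : ℝ) ≤ (2 : ℝ) ^ (r : ℝ) := by
    rw [Real.rpow_natCast]
    exact_mod_cast h.natCard_extremePoints_le
  rcases Nat.eq_zero_or_pos (Nat.card (P.extremePoints ℝ)) with h0 | hpos
  · rw [h0, Nat.cast_zero, Real.logb_zero]
    exact Nat.cast_nonneg r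
  · exact (Real.logb_le_iff_le_rpow one_lt_two (by exact_mod_cast hpos)).2 hle

/-! ### The permutahedron (Corollary 1) -/

/-- Strict preference by a linear functional makes a generator an extreme point of the hull: if
`p ∈ S` and `⟨c, q⟩ < ⟨c, p⟩` for every other `q ∈ S`, then `p` is an extreme point of `conv S`.
[cite: Goemans2015, §2 ("The permutahedron P_n has n! vertices")] -/
theorem mem_extremePoints_convexHull_of_dotProduct_lt {S : Set (ι → ℝ)} {p c : ι → ℝ} (hp : p ∈ S)
    (hlt : ∀ q ∈ S, q ≠ p → c ⬝ᵥ q < c ⬝ᵥ p) : p ∈ (convexHull ℝ S).extremePoints ℝ := by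
  classical
  have hlin : IsLinearMap ℝ (fun x : ι → ℝ => c ⬝ᵥ x) := by
    constructor
    · intro x y
      exact dotProduct_add c x y
    · intro a x
      exact dotProduct_smul a c x
  -- `⟨c, ·⟩ ≤ ⟨c, p⟩` on the hull
  have hle : ∀ x ∈ convexHull ℝ S, c ⬝ᵥ x ≤ c ⬝ᵥ p := by
    intro x hx
    refine convexHull_min (fun q hq => ?_) (convex_halfSpace_le hlin (c ⬝ᵥ p)) hx
    show c ⬝ᵥ q ≤ c ⬝ᵥ p
    by_cases hqp : q = p
    · subst hqp
      exact le_refl _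
    · exact (hlt q hq hqp).le
  -- the maximisers on the hull reduce to `p`
  have hmax : ∀ x ∈ convexHull ℝ S, c ⬝ᵥ p ≤ c ⬝ᵥ x → x = p := by
    intro x hx hcx
    set S' : Set (ι → ℝ) := S \ {p} with hS'
    by_cases hS'ne : S'.Nonempty
    · have hSeq : S = insert p S' := by
        rw [hS', Set.insert_sdiff_singleton, Set.insert_eq_of_mem hp]
      rw [hSeq, convexHull_insert hS'ne, mem_convexJoin] at hx
      obtain ⟨a, ha, q, hq, hxseg⟩ := hx
      rw [Set.mem_singleton_iff] at ha
      subst ha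
      have hq' : c ⬝ᵥ q < c ⬝ᵥ a :=
        convexHull_min (fun q hq => hlt q hq.1 hq.2) (convex_halfSpace_lt hlin (c ⬝ᵥ a)) hq
      obtain ⟨a', b', ha', hb', hab', rfl⟩ := hxseg
      have hb0 : b' = 0 := by
        by_contra hb0
        have hb'pos : 0 < b' := lt_of_le_of_ne hb' (Ne.symm hb0)
        have hlt' : c ⬝ᵥ (a' • a + b' • q) < c ⬝ᵥ a := by
          rw [dotProduct_add, dotProduct_smul, dotProduct_smul, smul_eq_mul, smul_eq_mul]
          have ha'1 : a' = 1 - b' := by linarith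
          rw [ha'1]
          nlinarith [mul_pos hb'pos (sub_pos.2 hq')]
        linarith
      subst hb0
      have ha1 : a' = 1 := by linarith
      subst ha1
      simp
    · have hSeq : S = {p} := by
        ext q
        constructor
        · intro hq
          by_contra hne
          exact hS'ne ⟨q, hq, hne⟩
        · rintro rfl
          exact hp
      rw [hSeq, convexHull_singleton, Set.mem_singleton_iff] at hx
      exact hx
  rw [mem_extremePoints]
  refine ⟨subset_convexHull ℝ S hp, fun x₁ hx₁ x₂ hx₂ hseg => ?_⟩
  obtain ⟨a, b, ha, hb, hab, hx⟩ := hseg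
  have h1 := hle x₁ hx₁
  have h2 := hle x₂ hx₂
  have heq : c ⬝ᵥ p = a * (c ⬝ᵥ x₁) + b * (c ⬝ᵥ x₂) := by
    rw [← hx, dotProduct_add, dotProduct_smul, dotProduct_smul, smul_eq_mul, smul_eq_mul]
  have hsplit : a * (c ⬝ᵥ p) + b * (c ⬝ᵥ p) = c ⬝ᵥ p := by rw [← add_mul, hab, one_mul]
  have h1' : c ⬝ᵥ p ≤ c ⬝ᵥ x₁ := by
    by_contra hlt1
    have hlt1' : c ⬝ᵥ x₁ < c ⬝ᵥ p := lt_of_not_ge hlt1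
    have := mul_lt_mul_of_pos_left hlt1' ha
    have := mul_le_mul_of_nonneg_left h2 hb.le
    linarith
  have h2' : c ⬝ᵥ p ≤ c ⬝ᵥ x₂ := by
    by_contra hlt2
    have hlt2' : c ⬝ᵥ x₂ < c ⬝ᵥ p := lt_of_not_ge hlt2
    have := mul_lt_mul_of_pos_left hlt2' hb
    have := mul_le_mul_of_nonneg_left h1 ha.le
    linarith
  exact ⟨hmax x₁ hx₁ h1', hmax x₂ hx₂ h2'⟩

variable {n : ℕ}

/-- The permutation vector `(σ(0)+1, …, σ(n−1)+1)` of `σ ∈ S_n` — "all permutations of the set of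
numbers `[n] := {1, ⋯, n}`". [cite: Goemans2015, §2] -/
def permVec (σ : Equiv.Perm (Fin n)) : Fin n → ℝ := fun i => ((σ i : ℕ) : ℝ) + 1

variable (n) in
/-- **The permutahedron** `P_n = conv{permutation vectors of (1, …, n)} ⊆ ℝⁿ`. [cite: Goemans2015, §2] -/
def permutahedron : Set (Fin n → ℝ) := convexHull ℝ (Set.range (permVec (n := n)))

/-- Distinct permutations give distinct vectors. [cite: Goemans2015, §2 ("P_n has n! vertices")] -/
theorem permVec_injective : Function.Injective (permVec (n := n)) := by
  intro σ τ h
  ext i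
  have hi := congrFun h i
  simp only [permVec, add_left_inj, Nat.cast_inj] at hi
  exact hi

/-- `Σ_i v_σ(i)²` does not depend on `σ`. [cite: Goemans2015, §2] -/
theorem sum_permVec_sq (σ : Equiv.Perm (Fin n)) :
    ∑ i, permVec σ i ^ 2 = ∑ k : Fin n, (((k : ℕ) : ℝ) + 1) ^ 2 :=
  Equiv.sum_comp σ (fun k : Fin n => (((k : ℕ) : ℝ) + 1) ^ 2)

/-- `v_σ` is the unique maximiser of `⟨v_σ, ·⟩` among the permutation vectors:
`⟨v_σ, v_τ⟩ < ⟨v_σ, v_σ⟩` for `τ ≠ σ` (as `Σ (v_σ − v_τ)² > 0` and `|v_τ|² = |v_σ|²`).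
[cite: Goemans2015, §2 ("P_n has n! vertices")] -/
theorem permVec_dotProduct_lt {σ τ : Equiv.Perm (Fin n)} (h : τ ≠ σ) :
    permVec σ ⬝ᵥ permVec τ < permVec σ ⬝ᵥ permVec σ := by
  have hne : permVec τ ≠ permVec σ := fun h' => h (permVec_injective h')
  obtain ⟨i, hi⟩ : ∃ i, permVec τ i ≠ permVec σ i := by
    by_contra hall
    push Not at hall
    exact hne (funext hall)
  have hd : permVec σ i - permVec τ i ≠ 0 := sub_ne_zero.2 hi.symm
  have hsq : 0 < (permVec σ i - permVec τ i) ^ 2 :=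
    lt_of_le_of_ne (sq_nonneg _) (Ne.symm (pow_ne_zero 2 hd))
  have hpos : 0 < ∑ j, (permVec σ j - permVec τ j) ^ 2 :=
    lt_of_lt_of_le hsq (single_le_sum (f := fun j => (permVec σ j - permVec τ j) ^ 2)
      (fun j _ => sq_nonneg _) (mem_univ i))
  have hexp : ∑ j, (permVec σ j - permVec τ j) ^ 2 =
      ∑ j, permVec σ j ^ 2 - 2 * (permVec σ ⬝ᵥ permVec τ) + ∑ j, permVec τ j ^ 2 := by
    simp only [dotProduct, mul_sum, ← sum_sub_distrib, ← sum_add_distrib]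
    exact sum_congr rfl fun j _ => by ring
  rw [hexp, sum_permVec_sq τ, ← sum_permVec_sq σ] at hpos
  have hσσ : permVec σ ⬝ᵥ permVec σ = ∑ j, permVec σ j ^ 2 := by
    simp only [dotProduct]
    exact sum_congr rfl fun j _ => by ring
  rw [hσσ]
  linarith

/-- **"The permutahedron `P_n` has `n!` vertices"**: every permutation vector is an extreme point.
[cite: Goemans2015, §2] -/
theorem permVec_mem_extremePoints (σ : Equiv.Perm (Fin n)) :
    permVec σ ∈ (permutahedron n).extremePoints ℝ :=
  mem_extremePoints_convexHull_of_dotProduct_lt ⟨σ, rfl⟩ (by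
    rintro _ ⟨τ, rfl⟩ hne
    exact permVec_dotProduct_lt fun h => hne (by rw [h]))

/-- **Goemans 2015, Corollary 1** ("Any extended formulation `Q` of the permutahedron `P_n` has at
least `Ω(n log n)` facets"), in the explicit form of its proof: every extended formulation of `P_n`
with `r` inequalities has `n! ≤ 2^r` ("`v(P_n) = n! = 2^{Θ(n log n)}`"). [cite: Goemans2015, Cor. 1 (§2)] -/
theorem Goemans2015_cor1 {r : ℕ} (h : HasEFOfSize (permutahedron n) r) : n.factorial ≤ 2 ^ r := by
  classical
  haveI : Finite ((permutahedron n).extremePoints ℝ) := h.finite_extremePoints.to_subtype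
  let f : Equiv.Perm (Fin n) → (permutahedron n).extremePoints ℝ :=
    fun σ => ⟨permVec σ, permVec_mem_extremePoints σ⟩
  have hf : Function.Injective f := fun σ τ hστ => permVec_injective (congrArg Subtype.val hστ)
  calc n.factorial = Nat.card (Equiv.Perm (Fin n)) := by
        rw [Nat.card_eq_fintype_card, Fintype.card_perm, Fintype.card_fin]
    _ ≤ Nat.card ((permutahedron n).extremePoints ℝ) := Nat.card_le_card_of_injective f hf
    _ ≤ 2 ^ r := h.natCard_extremePoints_le

/-- **Corollary 1, logarithmic form**: `log₂ n! ≤ r` (and `log₂ n! = Θ(n log n)`).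
[cite: Goemans2015, Cor. 1 (§2)] -/
theorem Goemans2015_cor1_logb {r : ℕ} (h : HasEFOfSize (permutahedron n) r) :
    Real.logb 2 (n.factorial : ℝ) ≤ r := by
  have hle : (n.factorial : ℝ) ≤ (2 : ℝ) ^ (r : ℝ) := by
    rw [Real.rpow_natCast]
    exact_mod_cast Goemans2015_cor1 h
  exact (Real.logb_le_iff_le_rpow one_lt_two (by exact_mod_cast n.factorial_pos)).2 hle

end Literature.Barriers.PneNP
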